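import Mathlib
import HarnessLib
import Summits.NavierStokesRegularity.NavierStokesRegularity.Theorems.LocalPressureProfileDoorPressureWindowToSlab

/-!
# Route LocalLevelHeadDoor · crux `LevelHeadSpread` (stmt-NavierStokesRegularity-28096) · LINE g6-2 —
# the rung `levelHeadDecayVanish` (= registered stub `stub_levelDecayVanish`, PROVED by the planner)

Text VERBATIM from ns-idea-6 g6's HOME rung `lines/LocalLevelHeadDoor/LevelHead_rung.lean`, landed by ns-sz-p1 g5 on
director-ns DIRECTOR-NS #237 (2), `--supports stmt-NavierStokesRegularity-28096 --as helper`.  CONTENT: a door-class profile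
whose similarity head `y ↦ (−t)(Q[v(t)] + ½|v(t)|²)(√(−t)y)` is level at EVERY pair of similarity positions has zero head on
every slice (apex pressure bound `abs_profilePressure_le` + the space–time decay send the constant to `0`).

HONEST FRAMING: nothing here bears on the door's Target, 0056 or Navier–Stokes regularity.
-/

noncomputable section

set_option linter.dupNamespace false

namespace Summit.NavierStokesRegularity.NavierStokesRegularity.Cruxes.LevelHeadProfileRigidity.PointwiseClock
open scoped BigOperators Topology Classical InnerProductSpace RealInnerProductSpace
open Filter Set Function
open Literature.Analysis.FluidPDE
open Summit.NavierStokesRegularity.NavierStokesRegularity.Theorems.LocalPressureProfileDoorPressureWindowToSlab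
  (abs_profilePressure_le)

/-- **Level-head decay vanishing (PROVED stub = the crux `LevelHeadSpread` with window ℝ³)**. -/
theorem levelHeadDecayVanish : ∀ (C D : ℝ) (v : ℝ → EuclideanSpace ℝ (Fin 3) → EuclideanSpace ℝ (Fin 3)), Literature.Analysis.FluidPDE.HasTypeITimeDecay C v → Literature.Analysis.FluidPDE.HasTypeIDecay D v → ContinuousOn (Function.uncurry v) (Set.Iio (0 : ℝ) ×ˢ Set.univ) → (∀ s t : ℝ, s < t → t < 0 → ∀ x, v t x = Literature.Analysis.UnboundedOperators.heatExtension (v s) (t - s) x - Literature.Analysis.FluidPDE.oseenDuhamel 1 s v v t x) → (∀ t < 0, Literature.Analysis.FluidPDE.VectorCalculus.IsDivFree (v t)) → (∀ t < 0, ∀ y y' : EuclideanSpace ℝ (Fin 3), (-t) * (Literature.Analysis.FluidPDE.pressurePotential (v t) (Real.sqrt (-t) • y) + ‖v t (Real.sqrt (-t) • y)‖ ^ 2 / 2) = (-t) * (Literature.Analysis.FluidPDE.pressurePotential (v t) (Real.sqrt (-t) • y') + ‖v t (Real.sqrt (-t) • y')‖ ^ 2 / 2)) → ∀ t < 0, ∀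 z : EuclideanSpace ℝ (Fin 3), Literature.Analysis.FluidPDE.pressurePotential (v t) z + ‖v t z‖ ^ 2 / 2 = 0 := by
  intro C D v _hrate hdec hcont hmild hdiv hlevel t ht z
  obtain ⟨K, hK0, hK⟩ := abs_profilePressure_le hdec hcont hmild hdiv
  have hnt : 0 < -t := neg_pos.2 ht
  have hs : 0 < Real.sqrt (-t) := Real.sqrt_pos.2 hnt
  set G : EuclideanSpace ℝ (Fin 3) → ℝ := fun y =>
    (-t) * (pressurePotential (v t) (Real.sqrt (-t) • y) + ‖v t (Real.sqrt (-t) • y)‖ ^ 2 / 2) with hG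
  have hGb : ∀ y, |G y| ≤ (K + D ^ 2 / 2) / (‖y‖ + 1) ^ 2 := by
    intro y
    have h1 := hK t ht y
    have h2 := hdec t ht (Real.sqrt (-t) • y)
    have hn : ‖Real.sqrt (-t) • y‖ + Real.sqrt (-t) = Real.sqrt (-t) * (‖y‖ + 1) := by
      rw [norm_smul, Real.norm_of_nonneg hs.le]; ring
    rw [hn] at h2
    have hy1 : 0 < ‖y‖ + 1 := by positivity
    have h3 : (-t) * (‖v t (Real.sqrt (-t) • y)‖ ^ 2 / 2) ≤ D ^ 2 / 2 / (‖y‖ + 1) ^ 2 := by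
      have hsq : ‖v t (Real.sqrt (-t) • y)‖ ^ 2 ≤ (D / (Real.sqrt (-t) * (‖y‖ + 1))) ^ 2 :=
        pow_le_pow_left₀ (norm_nonneg _) h2 2
      have e1 : (-t) * ((D / (Real.sqrt (-t) * (‖y‖ + 1))) ^ 2 / 2) = D ^ 2 / 2 / (‖y‖ + 1) ^ 2 := by
        have htne : t ≠ 0 := ht.ne
        have hy1ne : ‖y‖ + 1 ≠ 0 := hy1.ne'
        rw [div_pow, mul_pow, Real.sq_sqrt hnt.le]
        field_simp
      calc (-t) * (‖v t (Real.sqrt (-t) • y)‖ ^ 2 / 2)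
          ≤ (-t) * ((D / (Real.sqrt (-t) * (‖y‖ + 1))) ^ 2 / 2) :=
            mul_le_mul_of_nonneg_left (by linarith) hnt.le
        _ = D ^ 2 / 2 / (‖y‖ + 1) ^ 2 := e1
    have h4 : 0 ≤ (-t) * (‖v t (Real.sqrt (-t) • y)‖ ^ 2 / 2) := by positivity
    have eG : G y = (-t) * pressurePotential (v t) (Real.sqrt (-t) • y) + (-t) * (‖v t (Real.sqrt (-t) • y)‖ ^ 2 / 2) := by
      rw [hG]; ring
    calc |G y| = |(-t) * pressurePotential (v t) (Real.sqrt (-t) • y) + (-t) * (‖v t (Real.sqrt (-t) • y)‖ ^ 2 / 2)| := by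
          rw [eG]
      _ ≤ |(-t) * pressurePotential (v t) (Real.sqrt (-t) • y)| + |(-t) * (‖v t (Real.sqrt (-t) • y)‖ ^ 2 / 2)| :=
          abs_add_le _ _
      _ ≤ K / (‖y‖ + 1) ^ 2 + D ^ 2 / 2 / (‖y‖ + 1) ^ 2 := by
          rw [abs_of_nonneg h4]; exact add_le_add h1 h3
      _ = (K + D ^ 2 / 2) / (‖y‖ + 1) ^ 2 := by ring
  have hconst : ∀ y y', G y = G y' := fun y y' => hlevel t ht y y'
  have hG0 : ∀ y, G y = 0 := by
    intro y
    by_contra hne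
    have hpos : 0 < |G y| := abs_pos.2 hne
    have hK' : 0 ≤ K + D ^ 2 / 2 := by positivity
    obtain ⟨n, hn⟩ := exists_nat_gt (Real.sqrt ((K + D ^ 2 / 2) / |G y|))
    set y' : EuclideanSpace ℝ (Fin 3) := (n : ℝ) • EuclideanSpace.single (0 : Fin 3) (1 : ℝ) with hy'
    have hny : ‖y'‖ = n := by
      rw [hy', norm_smul, PiLp.norm_single, Real.norm_of_nonneg (Nat.cast_nonneg n)]
      simp
    have hb := hGb y'
    rw [← hconst y y', hny] at hb
    have h5 : (K + D ^ 2 / 2) / |G y| < ((n : ℝ) + 1) ^ 2 := by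
      have h6 : Real.sqrt ((K + D ^ 2 / 2) / |G y|) < (n : ℝ) + 1 := by linarith
      have h7 := pow_lt_pow_left₀ h6 (Real.sqrt_nonneg _) two_ne_zero
      rwa [Real.sq_sqrt (div_nonneg hK' hpos.le)] at h7
    rw [div_lt_iff₀ hpos] at h5
    rw [le_div_iff₀ (by positivity)] at hb
    linarith
  have h1 := hG0 ((Real.sqrt (-t))⁻¹ • z)
  simp only [hG, smul_smul, mul_inv_cancel₀ hs.ne', one_smul] at h1
  exact (mul_eq_zero.1 h1).resolve_left hnt.ne'

/-- Alias under the skeleton's stub name (`StubLevelDecayVanish` verbatim). [folklore] -/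
theorem stub_levelDecayVanish : ∀ (C D : ℝ) (v : ℝ → EuclideanSpace ℝ (Fin 3) → EuclideanSpace ℝ (Fin 3)), Literature.Analysis.FluidPDE.HasTypeITimeDecay C v → Literature.Analysis.FluidPDE.HasTypeIDecay D v → ContinuousOn (Function.uncurry v) (Set.Iio (0 : ℝ) ×ˢ Set.univ) → (∀ s t : ℝ, s < t → t < 0 → ∀ x, v t x = Literature.Analysis.UnboundedOperators.heatExtension (v s) (t - s) x - Literature.Analysis.FluidPDE.oseenDuhamel 1 s v v t x) → (∀ t < 0, Literature.Analysis.FluidPDE.VectorCalculus.IsDivFree (v t)) → (∀ t < 0, ∀ y y' : EuclideanSpace ℝ (Fin 3), (-t) * (Literature.Analysis.FluidPDE.pressurePotential (v t) (Real.sqrt (-t) • y) + ‖v t (Real.sqrt (-t) • y)‖ ^ 2 / 2) = (-t) * (Literature.Analysis.FluidPDE.pressurePotential (v t) (Real.sqrt (-t) • y') + ‖v t (Real.sqrt (-t) • y')‖ ^ 2 / 2)) → ∀ t < 0, ∀ z : EuclideanSpace ℝ (Fin 3), Literature.Analysis.FluidPDE.pressurePotential (v t) z + ‖v t z‖ ^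 2 / 2 = 0 :=
  levelHeadDecayVanish

end Summit.NavierStokesRegularity.NavierStokesRegularity.Cruxes.LevelHeadProfileRigidity.PointwiseClock

end
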